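import Summits.AtomisticToContinuum.Crystallization.Theorems.ChargedEnergyGapCoreFree
import HarnessLib

/-!
# `ChargedEnergyGap` — the MAX-COVER far weight (repair proposal R1 for the cored far floor)
# (cell `decomp-a2c`, lens 3, generation 51, node «CoreFree», part N-B = REPAIR-PROPOSAL; over part N-A)

NOT IN THE RECORD CONE.  This part types the repair that the generation-51 transfer audit recommends for the far weight of part I-A
(`…Theorems.ChargedEnergyGapBallWeights`), proves its invariants, and compares it with the weight of record; re-chaining parts
I-B…M-A over it (accounts, conservation, separated/guarded/regular/clean ledgers) is mechanical and deferred to the critic's ruling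
and census C10/C11.

THE DEFECT OF RECORD (memo g51 §2).  The far weight of record is `w = ((1 − S)₊)⁴` with the SUM cover `S = Σ_cores bump_x`.  Around
`n` nearby cores `S ≈ n` out to distance `ϱ/2` and `S < 1` only in a thin outer shell: the transition region `{0 < w < 1}` has width
`≈ ϱ/(2·(35n)^{1/4})` around `n` coincident cores, `≈ (ϱ^{7/2}/(644λ_c))^{2/9} ≈ 9` along a line of `λ_c ≈ 3` core sites per unit
length (`ϱ = 160`), `≈ 4.5` along a wall — instead of the designed `ϱ/2 = 80`.  The first-order transfer between the far account
and the balls (third moment `Σ_v V'|v|³ = 12.0`, force `−0.2·w'''` per unit shell-normal displacement) scales like `TV(w'')²/Λ³` in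
the width `Λ`, so thin shells make the far floor's slack `c₁ = 1/20` per core insufficient for line cores (`≈ 0.9` vs `≈ 0.2–0.4`
per unit length).

THE REPAIR.  Replace the SUM inside the far weight by the MAXIMUM: `coverMax q := max_x coreBump_x q ∈ [0, 1]` and
`farWeightM := (1 − coverMax)⁴`.  Since every bump is a fixed profile of the distance to its core orbit, `coverMax` is that profile
of the distance to the NEAREST core orbit: the transition shell `{0 < farWeightM < 1} = {ϱ/2 < d_core < ϱ}` has the full width
`ϱ/2` for EVERY core geometry (isolated, clustered, line, wall); the only new non-smooth features are the creases on the
bisectors between distant cores, where `∇w` jumps — invisible to the transfer at first order by the virial identity.  Transfer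
after repair (audit): `≈ 10⁻²` per unit length of line core (slack `0.17–0.36`), `≈ 1–3` per isolated compact core.  The ball
weights keep the Σ-sharing of the complement: `ballWeightM_x := coreBump_x·(1 − farWeightM)/coverSum`, so ★ `Σ_x ballWeightM_x +
farWeightM = 1` exactly (`ballWeightM_sum_add_farWeightM`).  Everything parts I-B…M-A use about the weights survives: values in
`[0, 1]`, far weight `0` at (indeed within `ϱ/2` of) every core, positive far weight ⟹ every core orbit beyond `ϱ/2`
(`lt_orbitDist_of_farWeightM_pos`), `Λ`-periodicity, and ★ `farWeight ≤ farWeightM` (the repair only ENLARGES the far weight: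
the repaired far floor implies nothing weaker about which sites are far).

§1 `coverMax`, `farWeightM`, `ballWeightM`.  §2 Bounds, core values, comparison with the cover and far weight of record, positivity ⟹
separation from the cores, ★ partition of unity.  §3 `Λ`-periodicity.

TAGS.  REPAIR-PROPOSAL (R1 of memo g51) · definitions + invariants PROVED · not a piece; the re-based far floor CB-FAR_G′ (same text as
`FarLabelledFloorG` with `farWeightM`) is TRUE-leaning by the audit and inherits the EQUIV of part N-A verbatim. -/

noncomputable section
open scoped Classical
open Literature.MathematicalPhysics.StatisticalMechanics
open Literature.Geometry.DiscreteGeometry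
open Summit.AtomisticToContinuum.Crystallization.Theses.PricedLinkCensus
open Summit.AtomisticToContinuum.Crystallization.Theorems.ChargedEnergyGapNegative

namespace Summit.AtomisticToContinuum.Crystallization.Theorems.ChargedEnergyGapChartDial

/-- The motif type of a periodic configuration is nonempty. -/
theorem nonempty_motif (Q : PeriodicConfiguration 3) : Nonempty Q.motif :=
  Q.motif_nonempty.to_subtype

/-! ## §1 The max-cover weights -/

section MaxCover

variable (θ ε R r η L δ L' ϱ : ℝ)

/-- The **MAX-COVER**: the largest core bump at `q` (`0` if there is no core) — the bump profile of the distance to the nearest core orbit. -/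
def coverMax (Q : PeriodicConfiguration 3) (q : E3) : ℝ :=
  ⨆ x : Q.motif, coreBump θ ε R r η L δ L' ϱ Q x q

/-- The **MAX-COVER FAR WEIGHT** `(1 − coverMax)⁴`: `0` within `ϱ/2` of a core orbit, `1` beyond `ϱ` from all of them, a fixed C³
profile of the distance to the nearest core orbit in between (width `ϱ/2` for every core geometry). -/
def farWeightM (Q : PeriodicConfiguration 3) (q : E3) : ℝ :=
  (1 - coverMax θ ε R r η L δ L' ϱ Q q) ^ 4

/-- The **MAX-COVER BALL WEIGHT** of core `x`: its bump's share (Σ-sharing) of the complement `1 − farWeightM`. -/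
def ballWeightM (Q : PeriodicConfiguration 3) (x : Q.motif) (q : E3) : ℝ :=
  coreBump θ ε R r η L δ L' ϱ Q x q * (1 - farWeightM θ ε R r η L δ L' ϱ Q q) / coverSum θ ε R r η L δ L' ϱ Q q

variable {θ ε R r η L δ L' ϱ}

/-! ## §2 Invariants -/

/-- Core bumps are at most `1`. -/
theorem coreBump_le_one (Q : PeriodicConfiguration 3) (x : Q.motif) (q : E3) : coreBump θ ε R r η L δ L' ϱ Q x q ≤ 1 := by
  unfold coreBump; split_ifs
  · exact bump_le_one ϱ Q x q
  · exact zero_le_one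

/-- Each core bump is below the max-cover. -/
theorem coreBump_le_coverMax (Q : PeriodicConfiguration 3) (x : Q.motif) (q : E3) :
    coreBump θ ε R r η L δ L' ϱ Q x q ≤ coverMax θ ε R r η L δ L' ϱ Q q :=
  le_ciSup (Set.finite_range fun x : Q.motif => coreBump θ ε R r η L δ L' ϱ Q x q).bddAbove x

/-- The max-cover is attained at some motif site. -/
theorem exists_coverMax_eq (Q : PeriodicConfiguration 3) (q : E3) :
    ∃ x : Q.motif, coreBump θ ε R r η L δ L' ϱ Q x q = coverMax θ ε R r η L δ L' ϱ Q q := by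
  haveI := nonempty_motif Q
  exact exists_eq_ciSup_of_finite

/-- The max-cover is non-negative … -/
theorem coverMax_nonneg (Q : PeriodicConfiguration 3) (q : E3) : 0 ≤ coverMax θ ε R r η L δ L' ϱ Q q :=
  Real.iSup_nonneg fun x => coreBump_nonneg Q x q

/-- … and at most `1` (no clamp is needed in `farWeightM`). -/
theorem coverMax_le_one (Q : PeriodicConfiguration 3) (q : E3) : coverMax θ ε R r η L δ L' ϱ Q q ≤ 1 := by
  haveI := nonempty_motif Q
  exact ciSup_le fun x => coreBump_le_one Q x q

/-- The max-cover is dominated by the sum cover of record. -/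
theorem coverMax_le_coverSum (Q : PeriodicConfiguration 3) (q : E3) :
    coverMax θ ε R r η L δ L' ϱ Q q ≤ coverSum θ ε R r η L δ L' ϱ Q q := by
  obtain ⟨x, hx⟩ := exists_coverMax_eq (θ := θ) (ε := ε) (R := R) (r := r) (η := η) (L := L) (δ := δ) (L' := L') (ϱ := ϱ) Q q
  rw [← hx]
  exact Finset.single_le_sum (f := fun x' : Q.motif => coreBump θ ε R r η L δ L' ϱ Q x' q) (fun x' _ => coreBump_nonneg Q x' q)
    (Finset.mem_univ x)

/-- Core-free ⟹ the max-cover vanishes. -/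
theorem coverMax_eq_zero_of_not_isCore {Q : PeriodicConfiguration 3} (h : ∀ x : Q.motif, ¬ IsCore θ ε R r η L δ L' Q x) (q : E3) :
    coverMax θ ε R r η L δ L' ϱ Q q = 0 := by
  haveI := nonempty_motif Q
  have hf : (fun x : Q.motif => coreBump θ ε R r η L δ L' ϱ Q x q) = fun _ => 0 := funext fun x => coreBump_of_not_isCore (h x) q
  unfold coverMax; rw [hf]; exact ciSup_const

/-- Zero sum cover ⟹ zero max-cover. -/
theorem coverMax_eq_zero_of_coverSum_eq_zero {Q : PeriodicConfiguration 3} {q : E3} (hS : coverSum θ ε R r η L δ L' ϱ Q q = 0) :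
    coverMax θ ε R r η L δ L' ϱ Q q = 0 :=
  le_antisymm (hS ▸ coverMax_le_coverSum Q q) (coverMax_nonneg Q q)

/-- At an incoherent core site the max-cover is `1`. -/
theorem coverMax_eq_one_of_isCore {Q : PeriodicConfiguration 3} {y : Q.motif} (hy : IsCore θ ε R r η L δ L' Q y) :
    coverMax θ ε R r η L δ L' ϱ Q (y : E3) = 1 := by
  refine le_antisymm (coverMax_le_one Q _) ?_
  have h1 : coreBump θ ε R r η L δ L' ϱ Q y (y : E3) = 1 := by rw [coreBump, if_pos hy, bump_self]
  rw [← h1]; exact coreBump_le_coverMax Q y _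

/-- Within `ϱ/2` of an incoherent core orbit the max-cover is `1` (`0 < ϱ`). -/
theorem coverMax_eq_one_of_orbitDist_le (hϱ : 0 < ϱ) {Q : PeriodicConfiguration 3} {x : Q.motif} (hx : IsCore θ ε R r η L δ L' Q x)
    {q : E3} (hq : orbitDist Q x q ≤ ϱ / 2) : coverMax θ ε R r η L δ L' ϱ Q q = 1 := by
  refine le_antisymm (coverMax_le_one Q _) ?_
  have h1 : coreBump θ ε R r η L δ L' ϱ Q x q = 1 := by rw [coreBump, if_pos hx, bump_eq_one_of_le hϱ hq]
  rw [← h1]; exact coreBump_le_coverMax Q x _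

/-- The max-cover far weight is non-negative … -/
theorem farWeightM_nonneg (Q : PeriodicConfiguration 3) (q : E3) : 0 ≤ farWeightM θ ε R r η L δ L' ϱ Q q :=
  pow_nonneg (sub_nonneg.2 (coverMax_le_one Q q)) 4

/-- … and at most `1`. -/
theorem farWeightM_le_one (Q : PeriodicConfiguration 3) (q : E3) : farWeightM θ ε R r η L δ L' ϱ Q q ≤ 1 := by
  have h0 := coverMax_nonneg (θ := θ) (ε := ε) (R := R) (r := r) (η := η) (L := L) (δ := δ) (L' := L') (ϱ := ϱ) Q q
  have h1 := coverMax_le_one (θ := θ) (ε := ε) (R := R) (r := r) (η := η) (L := L) (δ := δ) (L' := L') (ϱ := ϱ) Q q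
  unfold farWeightM
  nlinarith [pow_le_one₀ (sub_nonneg.2 h1) (by linarith : 1 - coverMax θ ε R r η L δ L' ϱ Q q ≤ 1) (n := 4)]

/-- Zero max-cover ⟹ far weight `1` … -/
theorem farWeightM_eq_one_of_coverMax_eq_zero {Q : PeriodicConfiguration 3} {q : E3} (h : coverMax θ ε R r η L δ L' ϱ Q q = 0) :
    farWeightM θ ε R r η L δ L' ϱ Q q = 1 := by
  simp [farWeightM, h]

/-- … in particular core-free ⟹ the max-cover far weight is identically `1` (as for the weight of record). -/
theorem farWeightM_eq_one_of_not_isCore {Q : PeriodicConfiguration 3} (h : ∀ x : Q.motif, ¬ IsCore θ ε R r η L δ L' Q x) (q : E3) :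
    farWeightM θ ε R r η L δ L' ϱ Q q = 1 :=
  farWeightM_eq_one_of_coverMax_eq_zero (coverMax_eq_zero_of_not_isCore h q)

/-- Max-cover `1` ⟹ far weight `0` … -/
theorem farWeightM_eq_zero_of_coverMax_eq_one {Q : PeriodicConfiguration 3} {q : E3} (h : coverMax θ ε R r η L δ L' ϱ Q q = 1) :
    farWeightM θ ε R r η L δ L' ϱ Q q = 0 := by
  simp [farWeightM, h]

/-- … so ★ incoherent cores carry NO max-cover far weight … -/
theorem farWeightM_eq_zero_of_isCore {Q : PeriodicConfiguration 3} {y : Q.motif} (hy : IsCore θ ε R r η L δ L' Q y) :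
    farWeightM θ ε R r η L δ L' ϱ Q (y : E3) = 0 :=
  farWeightM_eq_zero_of_coverMax_eq_one (coverMax_eq_one_of_isCore hy)

/-- … nor does anything within `ϱ/2` of a core orbit (`0 < ϱ`). -/
theorem farWeightM_eq_zero_of_orbitDist_le (hϱ : 0 < ϱ) {Q : PeriodicConfiguration 3} {x : Q.motif} (hx : IsCore θ ε R r η L δ L' Q x)
    {q : E3} (hq : orbitDist Q x q ≤ ϱ / 2) : farWeightM θ ε R r η L δ L' ϱ Q q = 0 :=
  farWeightM_eq_zero_of_coverMax_eq_one (coverMax_eq_one_of_orbitDist_le hϱ hx hq)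

/-- ★ Positive max-cover far weight ⟹ every incoherent core orbit is farther than `ϱ/2` (`0 < ϱ`) — the separation property the
ledgers of parts I-B…M-A use. -/
theorem lt_orbitDist_of_farWeightM_pos (hϱ : 0 < ϱ) {Q : PeriodicConfiguration 3} {q : E3} (hw : 0 < farWeightM θ ε R r η L δ L' ϱ Q q)
    {x : Q.motif} (hx : IsCore θ ε R r η L δ L' Q x) : ϱ / 2 < orbitDist Q x q := by
  by_contra hle
  exact absurd (farWeightM_eq_zero_of_orbitDist_le hϱ hx (not_lt.1 hle)) (ne_of_gt hw)

/-- ★ **THE REPAIR ONLY ENLARGES THE FAR WEIGHT**: `farWeight ≤ farWeightM` pointwise (`coverMax ≤ coverSum`). -/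
theorem farWeight_le_farWeightM (Q : PeriodicConfiguration 3) (q : E3) :
    farWeight θ ε R r η L δ L' ϱ Q q ≤ farWeightM θ ε R r η L δ L' ϱ Q q := by
  have h1 := coverMax_le_coverSum (θ := θ) (ε := ε) (R := R) (r := r) (η := η) (L := L) (δ := δ) (L' := L') (ϱ := ϱ) Q q
  have h2 := coverMax_le_one (θ := θ) (ε := ε) (R := R) (r := r) (η := η) (L := L) (δ := δ) (L' := L') (ϱ := ϱ) Q q
  have h3 : max 0 (1 - coverSum θ ε R r η L δ L' ϱ Q q) ≤ 1 - coverMax θ ε R r η L δ L' ϱ Q q :=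
    max_le (sub_nonneg.2 h2) (by linarith)
  unfold farWeight farWeightM
  exact pow_le_pow_left₀ (le_max_left _ _) h3 4

/-- Max-cover ball weights are non-negative. -/
theorem ballWeightM_nonneg (Q : PeriodicConfiguration 3) (x : Q.motif) (q : E3) : 0 ≤ ballWeightM θ ε R r η L δ L' ϱ Q x q :=
  div_nonneg (mul_nonneg (coreBump_nonneg Q x q) (sub_nonneg.2 (farWeightM_le_one Q q))) (coverSum_nonneg Q q)

/-- A site that is not an incoherent core has the zero max-cover ball weight. -/
theorem ballWeightM_of_not_isCore {Q : PeriodicConfiguration 3} {x : Q.motif} (hx : ¬ IsCore θ ε R r η L δ L' Q x) (q : E3) :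
    ballWeightM θ ε R r η L δ L' ϱ Q x q = 0 := by
  simp [ballWeightM, coreBump_of_not_isCore hx]

/-- ★ **PARTITION OF UNITY** for the max-cover weights (exact, everywhere, every parameter): `Σ_x ψᴹ_x + wᴹ = 1`. -/
theorem ballWeightM_sum_add_farWeightM (Q : PeriodicConfiguration 3) (q : E3) :
    (∑ x : Q.motif, ballWeightM θ ε R r η L δ L' ϱ Q x q) + farWeightM θ ε R r η L δ L' ϱ Q q = 1 := by
  by_cases hS : coverSum θ ε R r η L δ L' ϱ Q q = 0
  · have hball : ∀ x : Q.motif, ballWeightM θ ε R r η L δ L' ϱ Q x q = 0 := fun x => by simp [ballWeightM, hS]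
    simp [hball, farWeightM_eq_one_of_coverMax_eq_zero (coverMax_eq_zero_of_coverSum_eq_zero hS)]
  · have hsum : (∑ x : Q.motif, ballWeightM θ ε R r η L δ L' ϱ Q x q) =
        (∑ x : Q.motif, coreBump θ ε R r η L δ L' ϱ Q x q) * (1 - farWeightM θ ε R r η L δ L' ϱ Q q) /
          coverSum θ ε R r η L δ L' ϱ Q q := by
      rw [Finset.sum_mul, Finset.sum_div]; rfl
    rw [hsum, show (∑ x : Q.motif, coreBump θ ε R r η L δ L' ϱ Q x q) = coverSum θ ε R r η L δ L' ϱ Q q from rfl]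
    field_simp
    ring

/-- The max-cover ball weights sum to `1 −` the max-cover far weight. -/
theorem ballWeightM_sum_eq (Q : PeriodicConfiguration 3) (q : E3) :
    (∑ x : Q.motif, ballWeightM θ ε R r η L δ L' ϱ Q x q) = 1 - farWeightM θ ε R r η L δ L' ϱ Q q := by
  linarith [ballWeightM_sum_add_farWeightM (θ := θ) (ε := ε) (R := R) (r := r) (η := η) (L := L) (δ := δ) (L' := L') (ϱ := ϱ) Q q]

/-- Each max-cover ball weight is at most `1`. -/
theorem ballWeightM_le_one (Q : PeriodicConfiguration 3) (x : Q.motif) (q : E3) : ballWeightM θ ε R r η L δ L' ϱ Q x q ≤ 1 := by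
  calc ballWeightM θ ε R r η L δ L' ϱ Q x q ≤ ∑ x' : Q.motif, ballWeightM θ ε R r η L δ L' ϱ Q x' q :=
        Finset.single_le_sum (f := fun x' : Q.motif => ballWeightM θ ε R r η L δ L' ϱ Q x' q) (fun x' _ => ballWeightM_nonneg Q x' q)
          (Finset.mem_univ x)
    _ = 1 - farWeightM θ ε R r η L δ L' ϱ Q q := ballWeightM_sum_eq Q q
    _ ≤ 1 := by linarith [farWeightM_nonneg (θ := θ) (ε := ε) (R := R) (r := r) (η := η) (L := L) (δ := δ) (L' := L') (ϱ := ϱ) Q q]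

/-- At a core site the max-cover ball weights alone sum to `1`. -/
theorem ballWeightM_sum_of_isCore {Q : PeriodicConfiguration 3} {y : Q.motif} (hy : IsCore θ ε R r η L δ L' Q y) :
    (∑ x : Q.motif, ballWeightM θ ε R r η L δ L' ϱ Q x (y : E3)) = 1 := by
  rw [ballWeightM_sum_eq, farWeightM_eq_zero_of_isCore hy, sub_zero]

/-! ## §3 `Λ`-periodicity -/

/-- The max-cover is `Λ`-periodic. -/
theorem coverMax_add_period (Q : PeriodicConfiguration 3) {g : E3} (hg : g ∈ Q.lattice) (q : E3) :
    coverMax θ ε R r η L δ L' ϱ Q (q + g) = coverMax θ ε R r η L δ L' ϱ Q q := by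
  unfold coverMax; exact iSup_congr fun x => coreBump_add_period Q x hg q

/-- The max-cover far weight is `Λ`-periodic. -/
theorem farWeightM_add_period (Q : PeriodicConfiguration 3) {g : E3} (hg : g ∈ Q.lattice) (q : E3) :
    farWeightM θ ε R r η L δ L' ϱ Q (q + g) = farWeightM θ ε R r η L δ L' ϱ Q q := by
  unfold farWeightM; rw [coverMax_add_period Q hg q]

/-- The max-cover ball weights are `Λ`-periodic. -/
theorem ballWeightM_add_period (Q : PeriodicConfiguration 3) (x : Q.motif) {g : E3} (hg : g ∈ Q.lattice) (q : E3) :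
    ballWeightM θ ε R r η L δ L' ϱ Q x (q + g) = ballWeightM θ ε R r η L δ L' ϱ Q x q := by
  unfold ballWeightM; rw [coreBump_add_period Q x hg q, farWeightM_add_period Q hg q, coverSum_add_period Q hg q]

end MaxCover

end Summit.AtomisticToContinuum.Crystallization.Theorems.ChargedEnergyGapChartDial

end
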